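/-
Copyright: statement-level skeleton of a published paper (lit-balaban cell, Phase-2 proof seat p13, gen 6). No proof
claims beyond what the kernel checks below.
-/
import Literature.MathematicalPhysics.QuantumFieldTheory.BalabanImbrieJaffe1984to88.BIJ88DirichletForms305
import Literature.MathematicalPhysics.QuantumFieldTheory.Balaban1983to89.B4Sect5Proof

/-!
# `BalabanImbrieJaffe1984to88.BIJ88CsDecay305` — T. Bałaban, J. Imbrie, A. Jaffe, *Effective action and cluster
properties of the abelian Higgs model*, Commun. Math. Phys. **114** (1988) 257–315 [BalabanImbrieJaffe1988], §5.13
p. 305 [PDF 49]: **"Using the theorem on unit lattice operators in [6], we can invert this operator to yield an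
exponentially decaying covariance C_s = (−Δ_s)^{−1}"** — PROVED ON THE CARRIERS OF [6] = [Balaban1983RegularityDecay]
Sect. 5 (finite `Λ ⊂ ℤ^d`, kernels on `L²(Λ; ℝ^N)`): the hypothesis (5.6) of [6] passes from the inverse covariance to
EVERY Dirichlet form `Δ_Γ` and EVERY interpolated form `Δ_s`, `s ∈ [0,1]^I`, with the SAME constants, so [6]'s theorem
(the tree's `B4Sect5Proof`) inverts `Δ_s` with ONE pair of decay constants — uniformly in `s`, in the decomposition
`{□_i}_{i∈I}` and in `Λ`.

statement-level skeleton of published theorems with citation tags; proofs where landed; nothing here is a claim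
about the Yang–Mills mass gap

PDF held: `paper:balaban1988-cmp114-bij-abelian-higgs-effective-action` (journal page = PDF page + 256; pp. 305–306
read with `lit read … --pages 49-50`).

CITATION HEADER (lean-in-tree rule).  lit-balaban cell (HOME `run/shared/lean/pub/lit-balaban/`), Phase 2, seat p13
gen 6 (unit `lit-balaban-p13-g6`; lineage: the `ℤ^d` operator theorem of [6] Sect. 5, `B4Sect5Proof` /
`B4Sect5RandomWalk`, seats p13 g1–g5); row **C2.Eq5.13.3-5.13.4** of `HOME/lit-balaban-r16/ROWS-C2-part2.md` (owner
r16, referee ref-5), the p. 305 member «C_s = (−Δ_s)^{−1} exponentially decaying», listed as NOT claimed in the header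
of `…BIJ88DirichletForms305` (seat p02 gen 4, p252603: *"The exponential decay of C_s = (−Δ_s)^{−1} ('the theorem on
unit lattice operators in [6]' = B4's unit-lattice theorem, not imported)"*).  Files USED BY NAME, nothing restated:
`…BIJ88DirichletForms305` (`dirichletForm`, `dirichletForm_apply`, `dirichletForm_transpose`, `dirichletForm_neg`,
`interpForm`, `interpForm_apply`, `interpForm_transpose`, `interpForm_neg`, `quadForm_dirichletForm_ge`,
`quadForm_interpForm_ge`), `…Balaban1983to89.B4` (`Idx`, `Hyp56`, `compress`, `Concl57_58`, `Sect5ThmUniform`),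
`…Balaban1983to89.B4Sect5Proof` (`delta1`, `delta1_pos`, `isUnit_of_hyp56`, `inv_decay`, `sect5ThmUniform_holds`).

## The print (verbatim)

p. 305: *"To preserve positivity and boundedness properties of the inverse covariance, we define our s-dependent
inverse covariance by taking convex combinations of inverse covariances with Dirichlet boundary conditions. For an
arbitrary subset Γ of I we define Dirichlet forms: Δ_Γ = Σ_{i∈Γ} □_iΔ□_i + □^cΔ□^c … Δ_s = Π_{i∈I}[(1 − s_i)a_i + s_i]Δ
= Σ_{Γ⊂I} Π_{i∈Γ}(1 − s_i) Π_{i∈I∖Γ} s_i Δ_Γ. … we obtain that □_iΔ_s□_{i′} = s_is_{i′}□_iΔ□_{i′}, i′ ≠ i, □_iΔ_s□_i =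
□_iΔ□_i. Using the theorem on unit lattice operators in [6], we can invert this operator to yield an exponentially
decaying covariance C_s = (−Δ_s)^{−1}."*  p. 306: *"The form Δ has a range less than ½r(e_k)."*
[6] Sect. 5 Theorem, p. 594: *"Let Ω ⊂ Z^d and let A be a symmetric operator defined on the space L²(Ω) of
functions φ : Ω → R^N and satisfying the following condition: there exist positive constants γ₀, c₀, δ₀ such that
A ≥ γ₀I, |A(x,x′)| ≤ c₀e^{−δ₀|x−x′|}, x, x′ ∈ Ω. (5.6) Then there exist positive constants c₁, δ₁ such that for arbitrary
Λ ⊂ Ω and for C_Λ = A_Λ^{−1} … |C_Λ(x,x′)| ≤ c₁e^{−δ₁|x−x′|} (5.7)"* and p. 597 *"The constants δ₁, c₁ are functions of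
δ₀, γ₀, c₀"*.

## What is proved (0 `sorry`, standard axioms, theorems only)

`A` = the printed `−Δ` (the positive operator: `dirichletForm_neg` / `interpForm_neg` move the sign through, so
`(−Δ)_s = −(Δ_s)` and `C_s = ((−Δ)_s)^{−1}`), on [6]'s carriers `B4.Idx Λ N = Λ × Fin N`; `blk : B4.Idx Λ N → I` any
decomposition into "elementary regions" (print: regions of SITES, `blk p = β p.1`; the extra generality is free).
* §1 (any finite carriers) ENTRIES: `|(Δ_Γ)_{xy}| ≤ |Δ_{xy}|` (`abs_dirichletForm_apply_le`), `|(Δ_s)_{xy}| ≤ |Δ_{xy}|` for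
  `s ∈ [0,1]^I` (`abs_interpForm_apply_le`); SYMMETRY is inherited (`isSymm_dirichletForm`, `isSymm_interpForm`); the
  Dirichlet forms are the corners of the interpolation cube, `Δ_Γ = Δ_s` at `s = 1_{I∖Γ}` (`interpForm_corner`).
* §2 **(5.6) IS INHERITED** — the content of *"To preserve positivity and boundedness properties"* in [6]'s terms:
  `B4.Hyp56 Λ A γ₀ c₀ δ₀ → B4.Hyp56 Λ (Δ_Γ) γ₀ c₀ δ₀` (`hyp56_dirichletForm`) and `→ B4.Hyp56 Λ (Δ_s) γ₀ c₀ δ₀` for every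
  `s ∈ [0,1]^I` (`hyp56_interpForm`), SAME constants; and the feeder for the printed `Δ` — a symmetric form bounded below
  by `γ₀`, with entries bounded by `B` and RANGE `R` (p. 306: *"range less than ½r(e_k)"*), satisfies (5.6) with
  `c₀ = Be^{δ₀R}` for any `δ₀ ≥ 0` (`entryDecay_of_finiteRange`, `hyp56_of_finiteRange`).
* §3 **THE SENTENCE**: under (5.6) for `A` with `γ₀ > 0`, for every `s ∈ [0,1]^I`: `Δ_s` is invertible, `C_s := (Δ_s)^{−1}`
  is its two-sided inverse (`isUnit_interpForm`, `interpForm_mul_cs`, `cs_mul_interpForm`), and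
  **`|C_s(x,x′)| ≤ (2/γ₀)·e^{−δ₁|x−x′|}` with `δ₁ = B4Sect5Proof.delta1 d N γ₀ c₀ δ₀ > 0`** (`csDecay`; `csDecay_dirichlet` for
  the `Δ_Γ`; `csDecay_neg` in the printed sign convention) — the constants depend on `(γ₀, c₀, δ₀, d, N)` ONLY: uniform in
  `s`, `blk`, `I`, `Λ` (`csDecay_uniform`, the ∃(c₁,δ₁)∀(Λ,A,blk,s) packaging); and the full (5.7)–(5.8) of [6] for every
  Dirichlet restriction `(Δ_s)|_{Λ′}`, `Λ′ ⊆ Λ`, with uniform constants (`sect5_interpForm`).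
HONEST SCOPE.  Real kernels on `L²(Λ; ℝ^N)`, `Λ ⊂ ℤ^d` finite, sup-metric of `ℤ^d`, exactly as [6] is typed in the tree
(`B4.Hyp56`); that the print's inverse covariance `−Δ` (restricted to the axial subspace, p. 305) satisfies (5.6) is the
print's use of [6] and enters as the displayed hypothesis `B4.Hyp56 Λ A γ₀ c₀ δ₀` (its lower bound is the (5.13.2)
statement p. 304, `…BIJ88Form5132LowerBound`; its range is p. 306) — §2 only shows how range + bound feed (5.6).
NOT claimed: the expansion (5.13.3), the integration by parts, the factorization over clusters, anything of B1–B16.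
NOT summit progress; NOT continuum; NOT Clay.  No new `def`, no new `Prop` fact; modifies nothing.
-/

namespace Literature.MathematicalPhysics.QuantumFieldTheory.BalabanImbrieJaffe1984to88.BIJ88CsDecay305

open scoped BigOperators Matrix
open Finset
open Literature.MathematicalPhysics.QuantumFieldTheory.Balaban1983to89
open Literature.MathematicalPhysics.QuantumFieldTheory.BalabanImbrieJaffe1984to88
open BIJ88DirichletForms305

/-! ## §1  Entries and symmetry of `Δ_Γ`, `Δ_s` (any finite carriers) -/

section Generic

variable {α I : Type*} [Fintype α] [DecidableEq α] [DecidableEq I] (blk : α → I)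

/-- The entries of a Dirichlet form are entries of `Δ` or `0`: `|(Δ_Γ)_{xy}| ≤ |Δ_{xy}|`.
[cite: BalabanImbrieJaffe1988, §5.13 p.305] -/
theorem abs_dirichletForm_apply_le (Δ : Matrix α α ℝ) (Γ : Finset I) (x y : α) :
    |dirichletForm blk Δ Γ x y| ≤ |Δ x y| := by
  rw [dirichletForm_apply]
  split_ifs
  · exact le_rfl
  · rw [abs_zero]
    exact abs_nonneg _

/-- Symmetry is inherited by every Dirichlet form. [cite: BalabanImbrieJaffe1988, §5.13 p.305] -/
theorem isSymm_dirichletForm {Δ : Matrix α α ℝ} (hΔ : Δ.IsSymm) (Γ : Finset I) :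
    (dirichletForm blk Δ Γ).IsSymm := by
  unfold Matrix.IsSymm
  rw [dirichletForm_transpose, hΔ.eq]

variable [Fintype I]

/-- For `s ∈ [0,1]^I` the entries of `Δ_s` are entries of `Δ` damped by `s_is_{i′} ∈ [0,1]`:
`|(Δ_s)_{xy}| ≤ |Δ_{xy}|`. [cite: BalabanImbrieJaffe1988, §5.13 p.305] -/
theorem abs_interpForm_apply_le (Δ : Matrix α α ℝ) {s : I → ℝ} (hs : ∀ i, 0 ≤ s i ∧ s i ≤ 1) (x y : α) :
    |interpForm blk Δ s x y| ≤ |Δ x y| := by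
  rw [interpForm_apply]
  split_ifs
  · exact le_rfl
  · rw [abs_mul, abs_mul, abs_of_nonneg (hs _).1, abs_of_nonneg (hs _).1]
    have h1 : s (blk x) * s (blk y) ≤ 1 := by
      calc s (blk x) * s (blk y) ≤ 1 * 1 :=
            mul_le_mul (hs _).2 (hs _).2 (hs _).1 zero_le_one
        _ = 1 := one_mul 1
    calc s (blk x) * s (blk y) * |Δ x y| ≤ 1 * |Δ x y| :=
          mul_le_mul_of_nonneg_right h1 (abs_nonneg _)
      _ = |Δ x y| := one_mul _

/-- Symmetry is inherited by every interpolated form. [cite: BalabanImbrieJaffe1988, §5.13 p.305] -/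
theorem isSymm_interpForm {Δ : Matrix α α ℝ} (hΔ : Δ.IsSymm) (s : I → ℝ) :
    (interpForm blk Δ s).IsSymm := by
  unfold Matrix.IsSymm
  rw [interpForm_transpose, hΔ.eq]

/-- The Dirichlet forms are the corners of the interpolation cube: at `s = 1_{I∖Γ}` (`s_i = 0` on `Γ`, `1` off `Γ`),
`Δ_s = Δ_Γ` (so every statement below for `Δ_s`, `s ∈ [0,1]^I`, contains the one for `Δ_Γ`).
[cite: BalabanImbrieJaffe1988, §5.13 p.305] -/
theorem interpForm_corner {R : Type*} [CommRing R] (Δ : Matrix α α R) (Γ : Finset I) :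
    interpForm blk Δ (fun i => if i ∈ Γ then 0 else 1) = dirichletForm blk Δ Γ := by
  ext x y
  rw [interpForm_apply, dirichletForm_apply]
  by_cases hxy : blk x = blk y
  · rw [if_pos hxy, if_pos (Or.inl hxy)]
  · rw [if_neg hxy]
    by_cases hx : blk x ∈ Γ
    · rw [if_pos hx, zero_mul, zero_mul, if_neg (by tauto)]
    · by_cases hy : blk y ∈ Γ
      · rw [if_neg hx, if_pos hy, mul_zero, zero_mul, if_neg (by tauto)]
      · rw [if_neg hx, if_neg hy, one_mul, one_mul, if_pos (Or.inr ⟨hx, hy⟩)]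

end Generic

/-! ## §2  (5.6) of [6] is inherited by `Δ_Γ` and `Δ_s` -/

section Lattice

variable {d N : ℕ} {Λ : Finset (Fin d → ℤ)} {I : Type*} [DecidableEq I] (blk : B4.Idx Λ N → I)
  {A : Matrix (B4.Idx Λ N) (B4.Idx Λ N) ℝ} {γ₀ c₀ δ₀ : ℝ}

omit [DecidableEq I] in
/-- The lower bound `A ≥ γ₀I` of (5.6) in `dotProduct` form. [cite: Balaban1983RegularityDecay, (5.6) p.594] -/
theorem formLower_of_hyp56 (hA : B4.Hyp56 Λ A γ₀ c₀ δ₀) (v : B4.Idx Λ N → ℝ) :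
    γ₀ * (v ⬝ᵥ v) ≤ v ⬝ᵥ (A *ᵥ v) := by
  have h := hA.2.1 v
  have e1 : v ⬝ᵥ v = ∑ p, v p ^ 2 := by simp [dotProduct, pow_two]
  rw [e1]
  exact h

/-- **(5.6) is inherited by every Dirichlet form `Δ_Γ`, with the same constants** (*"To preserve positivity and
boundedness properties of the inverse covariance … Dirichlet boundary conditions"*): symmetry, the lower bound
`γ₀` (`quadForm_dirichletForm_ge`) and the entry decay (`|(Δ_Γ)_{xy}| ≤ |Δ_{xy}|`).
[cite: BalabanImbrieJaffe1988, §5.13 p.305] -/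
theorem hyp56_dirichletForm (hA : B4.Hyp56 Λ A γ₀ c₀ δ₀) (Γ : Finset I) :
    B4.Hyp56 Λ (dirichletForm blk A Γ) γ₀ c₀ δ₀ := by
  refine ⟨isSymm_dirichletForm blk hA.1 Γ, fun v => ?_, fun p q => ?_⟩
  · have h := quadForm_dirichletForm_ge blk (formLower_of_hyp56 hA) Γ v
    have e1 : v ⬝ᵥ v = ∑ p, v p ^ 2 := by simp [dotProduct, pow_two]
    rw [e1] at h
    exact h
  · exact (abs_dirichletForm_apply_le blk A Γ p q).trans (hA.2.2 p q)

variable [Fintype I]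

/-- **(5.6) is inherited by every interpolated form `Δ_s`, `s ∈ [0,1]^I`, with the same constants** (*"convex
combinations of inverse covariances with Dirichlet boundary conditions"*): symmetry, the lower bound `γ₀`
(`quadForm_interpForm_ge`) and the entry decay (`|(Δ_s)_{xy}| ≤ |Δ_{xy}|`). [cite: BalabanImbrieJaffe1988, §5.13 p.305] -/
theorem hyp56_interpForm (hA : B4.Hyp56 Λ A γ₀ c₀ δ₀) {s : I → ℝ} (hs : ∀ i, 0 ≤ s i ∧ s i ≤ 1) :
    B4.Hyp56 Λ (interpForm blk A s) γ₀ c₀ δ₀ := by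
  refine ⟨isSymm_interpForm blk hA.1 s, fun v => ?_, fun p q => ?_⟩
  · have h := quadForm_interpForm_ge blk (formLower_of_hyp56 hA) hs v
    have e1 : v ⬝ᵥ v = ∑ p, v p ^ 2 := by simp [dotProduct, pow_two]
    rw [e1] at h
    exact h
  · exact (abs_interpForm_apply_le blk A hs p q).trans (hA.2.2 p q)

omit [DecidableEq I] [Fintype I] in
/-- FEEDER for the printed `Δ` (p. 306: *"The form Δ has a range less than ½r(e_k)"*): a kernel with entries bounded by
`B` and range `R` (`A(x,x′) = 0` for `|x − x′| > R`) has the entry decay of (5.6) with `c₀ = Be^{δ₀R}`, for any rate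
`δ₀ ≥ 0`. [cite: BalabanImbrieJaffe1988, §5.13 p.306] -/
theorem entryDecay_of_finiteRange {B R : ℝ} (hδ : 0 ≤ δ₀) (hB : ∀ p q : B4.Idx Λ N, |A p q| ≤ B)
    (hR : ∀ p q : B4.Idx Λ N, R < dist (p.1 : Fin d → ℤ) (q.1 : Fin d → ℤ) → A p q = 0) (p q : B4.Idx Λ N) :
    |A p q| ≤ B * Real.exp (δ₀ * R) * Real.exp (-(δ₀ * dist (p.1 : Fin d → ℤ) (q.1 : Fin d → ℤ))) := by
  have hB0 : 0 ≤ B := (abs_nonneg _).trans (hB p q)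
  by_cases h : R < dist (p.1 : Fin d → ℤ) (q.1 : Fin d → ℤ)
  · rw [hR p q h, abs_zero]
    positivity
  · push Not at h
    calc |A p q| ≤ B := hB p q
      _ = B * Real.exp (δ₀ * R) * Real.exp (-(δ₀ * R)) := by
          rw [mul_assoc, ← Real.exp_add, add_neg_cancel, Real.exp_zero, mul_one]
      _ ≤ B * Real.exp (δ₀ * R) * Real.exp (-(δ₀ * dist (p.1 : Fin d → ℤ) (q.1 : Fin d → ℤ))) := by
          refine mul_le_mul_of_nonneg_left (Real.exp_le_exp.mpr ?_) (by positivity)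
          exact neg_le_neg (mul_le_mul_of_nonneg_left h hδ)

omit [DecidableEq I] [Fintype I] in
/-- Hence a SYMMETRIC form bounded below by `γ₀`, with bounded entries and finite range, satisfies (5.6) of [6] — the
two printed inputs (positivity of the inverse covariance, (5.13.2) p. 304; range `< ½r(e_k)`, p. 306) in [6]'s format.
[cite: BalabanImbrieJaffe1988, §5.13 pp.304–306] -/
theorem hyp56_of_finiteRange {B R : ℝ} (hsymm : A.IsSymm)
    (hpos : ∀ v : B4.Idx Λ N → ℝ, γ₀ * ∑ p, v p ^ 2 ≤ ∑ p, v p * A.mulVec v p) (hδ : 0 ≤ δ₀)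
    (hB : ∀ p q : B4.Idx Λ N, |A p q| ≤ B)
    (hR : ∀ p q : B4.Idx Λ N, R < dist (p.1 : Fin d → ℤ) (q.1 : Fin d → ℤ) → A p q = 0) :
    B4.Hyp56 Λ A γ₀ (B * Real.exp (δ₀ * R)) δ₀ :=
  ⟨hsymm, hpos, entryDecay_of_finiteRange hδ hB hR⟩

/-! ## §3  The sentence: `C_s = (Δ_s)^{−1}` exists and decays exponentially, uniformly in `s` -/

/-- *"we can invert this operator"*: under (5.6) with `γ₀ > 0`, `Δ_s` is invertible for every `s ∈ [0,1]^I`.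
[cite: BalabanImbrieJaffe1988, §5.13 p.305] -/
theorem isUnit_interpForm (hγ : 0 < γ₀) (hA : B4.Hyp56 Λ A γ₀ c₀ δ₀) {s : I → ℝ} (hs : ∀ i, 0 ≤ s i ∧ s i ≤ 1) :
    IsUnit (interpForm blk A s) :=
  B4Sect5Proof.isUnit_of_hyp56 hγ (hyp56_interpForm blk hA hs)

/-- `C_s := (Δ_s)^{−1}` (Mathlib's `Matrix.inv`) is a right inverse: `Δ_sC_s = 1`. [cite: BalabanImbrieJaffe1988, §5.13 p.305] -/
theorem interpForm_mul_cs (hγ : 0 < γ₀) (hA : B4.Hyp56 Λ A γ₀ c₀ δ₀) {s : I → ℝ} (hs : ∀ i, 0 ≤ s i ∧ s i ≤ 1) :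
    interpForm blk A s * (interpForm blk A s)⁻¹ = 1 :=
  Matrix.mul_nonsing_inv _ ((Matrix.isUnit_iff_isUnit_det _).mp (isUnit_interpForm blk hγ hA hs))

/-- … and a left inverse: `C_sΔ_s = 1`. [cite: BalabanImbrieJaffe1988, §5.13 p.305] -/
theorem cs_mul_interpForm (hγ : 0 < γ₀) (hA : B4.Hyp56 Λ A γ₀ c₀ δ₀) {s : I → ℝ} (hs : ∀ i, 0 ≤ s i ∧ s i ≤ 1) :
    (interpForm blk A s)⁻¹ * interpForm blk A s = 1 :=
  Matrix.nonsing_inv_mul _ ((Matrix.isUnit_iff_isUnit_det _).mp (isUnit_interpForm blk hγ hA hs))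

/-- **THE SENTENCE, EXPLICIT FORM** — *"Using the theorem on unit lattice operators in [6], we can invert this operator
to yield an exponentially decaying covariance C_s = (−Δ_s)^{−1}"*: under (5.6) for `A` (= the printed `−Δ`), for every
`s ∈ [0,1]^I`, `|C_s(x,x′)| ≤ (2/γ₀)e^{−δ₁|x−x′|}` with `δ₁ = δ₁(d,N,γ₀,c₀,δ₀) > 0` of `B4Sect5Proof` — the same constants
for all `s`, all decompositions `blk` and all `Λ`. [cite: BalabanImbrieJaffe1988, §5.13 p.305] -/
theorem csDecay (hγ : 0 < γ₀) (hc : 0 ≤ c₀) (hδ : 0 < δ₀) (hA : B4.Hyp56 Λ A γ₀ c₀ δ₀) {s : I → ℝ}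
    (hs : ∀ i, 0 ≤ s i ∧ s i ≤ 1) (p q : B4.Idx Λ N) :
    |(interpForm blk A s)⁻¹ p q|
      ≤ 2 / γ₀ * Real.exp (-(B4Sect5Proof.delta1 d N γ₀ c₀ δ₀ * dist (p.1 : Fin d → ℤ) (q.1 : Fin d → ℤ))) :=
  B4Sect5Proof.inv_decay hγ hc hδ (hyp56_interpForm blk hA hs) p q

omit [Fintype I] in
/-- The same for the Dirichlet forms: `|(Δ_Γ)^{−1}(x,x′)| ≤ (2/γ₀)e^{−δ₁|x−x′|}`, uniformly in `Γ`.
[cite: BalabanImbrieJaffe1988, §5.13 p.305] -/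
theorem csDecay_dirichlet (hγ : 0 < γ₀) (hc : 0 ≤ c₀) (hδ : 0 < δ₀) (hA : B4.Hyp56 Λ A γ₀ c₀ δ₀) (Γ : Finset I)
    (p q : B4.Idx Λ N) :
    |(dirichletForm blk A Γ)⁻¹ p q|
      ≤ 2 / γ₀ * Real.exp (-(B4Sect5Proof.delta1 d N γ₀ c₀ δ₀ * dist (p.1 : Fin d → ℤ) (q.1 : Fin d → ℤ))) :=
  B4Sect5Proof.inv_decay hγ hc hδ (hyp56_dirichletForm blk hA Γ) p q

/-- THE PRINTED SIGN CONVENTION: with `Δ` the printed form (so that `−Δ` satisfies (5.6)), `C_s = (−Δ_s)^{−1}` and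
`|C_s(x,x′)| ≤ (2/γ₀)e^{−δ₁|x−x′|}` (`(−Δ)_s = −(Δ_s)`, `interpForm_neg`). [cite: BalabanImbrieJaffe1988, §5.13 p.305] -/
theorem csDecay_neg {Δ : Matrix (B4.Idx Λ N) (B4.Idx Λ N) ℝ} (hγ : 0 < γ₀) (hc : 0 ≤ c₀) (hδ : 0 < δ₀)
    (hΔ : B4.Hyp56 Λ (-Δ) γ₀ c₀ δ₀) {s : I → ℝ} (hs : ∀ i, 0 ≤ s i ∧ s i ≤ 1) (p q : B4.Idx Λ N) :
    |(-interpForm blk Δ s)⁻¹ p q|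
      ≤ 2 / γ₀ * Real.exp (-(B4Sect5Proof.delta1 d N γ₀ c₀ δ₀ * dist (p.1 : Fin d → ℤ) (q.1 : Fin d → ℤ))) := by
  rw [← interpForm_neg]
  exact csDecay blk hγ hc hδ hΔ hs p q

end Lattice

/-! ## §4  Uniformity packaged as in [6]: one pair of constants for all `Λ`, `A`, `{□_i}`, `s` -/

section Uniform

/-- **THE SENTENCE, [6]'s QUANTIFIER SHAPE**: for all positive `(γ₀, c₀, δ₀)` THERE ARE positive `(c₁, δ₁)` such that for
EVERY finite `Λ ⊂ ℤ^d`, every `A` on `L²(Λ; ℝ^N)` with (5.6), every decomposition `blk` into elementary regions and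
every `s ∈ [0,1]^I`, the covariance `C_s = (Δ_s)^{−1}` satisfies `|C_s(x,x′)| ≤ c₁e^{−δ₁|x−x′|}` — p. 597 of [6]: *"The
constants δ₁, c₁ are functions of δ₀, γ₀, c₀"*. [cite: BalabanImbrieJaffe1988, §5.13 p.305] -/
theorem csDecay_uniform (d N : ℕ) {γ₀ c₀ δ₀ : ℝ} (hγ : 0 < γ₀) (hc : 0 ≤ c₀) (hδ : 0 < δ₀) :
    ∃ c₁ δ₁ : ℝ, 0 < c₁ ∧ 0 < δ₁ ∧
      ∀ (Λ : Finset (Fin d → ℤ)) (A : Matrix (B4.Idx Λ N) (B4.Idx Λ N) ℝ), B4.Hyp56 Λ A γ₀ c₀ δ₀ →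
        ∀ {I : Type*} [Fintype I] [DecidableEq I] (blk : B4.Idx Λ N → I) (s : I → ℝ),
          (∀ i, 0 ≤ s i ∧ s i ≤ 1) → ∀ p q : B4.Idx Λ N,
            |(interpForm blk A s)⁻¹ p q| ≤ c₁ * Real.exp (-(δ₁ * dist (p.1 : Fin d → ℤ) (q.1 : Fin d → ℤ))) :=
  ⟨2 / γ₀, B4Sect5Proof.delta1 d N γ₀ c₀ δ₀, by positivity, B4Sect5Proof.delta1_pos d N hγ hc hδ,
    fun _ _ hA _ _ _ blk _ hs p q => csDecay blk hγ hc hδ hA hs p q⟩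

/-- **All of [6]'s (5.7)–(5.8) for the Dirichlet restrictions of `Δ_s`**: with the uniform constants `(c₁, δ₁)` of
[6]'s theorem (`B4.Sect5ThmUniform`, proved in `B4Sect5Proof`), for every `Λ′ ⊆ Λ` the restriction `(Δ_s)|_{Λ′}` has an
inverse decaying as (5.7), differing from `(Δ_s)^{−1}` as (5.8) — for all `Λ`, `A` with (5.6), `blk`, `s ∈ [0,1]^I`.
[cite: BalabanImbrieJaffe1988, §5.13 p.305] -/
theorem sect5_interpForm (d N : ℕ) {γ₀ c₀ δ₀ : ℝ} (hγ : 0 < γ₀) (hc : 0 < c₀) (hδ : 0 < δ₀) :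
    ∃ c₁ δ₁ : ℝ, 0 < c₁ ∧ 0 < δ₁ ∧
      ∀ (Λ : Finset (Fin d → ℤ)) (A : Matrix (B4.Idx Λ N) (B4.Idx Λ N) ℝ), B4.Hyp56 Λ A γ₀ c₀ δ₀ →
        ∀ {I : Type*} [Fintype I] [DecidableEq I] (blk : B4.Idx Λ N → I) (s : I → ℝ),
          (∀ i, 0 ≤ s i ∧ s i ≤ 1) →
            ∀ (Λ' : Finset (Fin d → ℤ)) (h : Λ' ⊆ Λ), B4.Concl57_58 Λ Λ' h (interpForm blk A s) c₁ δ₁ := by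
  obtain ⟨c₁, δ₁, hc₁, hδ₁, H⟩ := B4Sect5Proof.sect5ThmUniform_holds d N γ₀ c₀ δ₀ hγ hc hδ
  exact ⟨c₁, δ₁, hc₁, hδ₁, fun Λ _ hA _ _ _ blk _ hs Λ' h => (H Λ _ (hyp56_interpForm blk hA hs)).1 Λ' h⟩

end Uniform

end Literature.MathematicalPhysics.QuantumFieldTheory.BalabanImbrieJaffe1984to88.BIJ88CsDecay305
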